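import Summits.NavierStokesRegularity.NavierStokesRegularity.Theorems.TypeICertificateLadderTargetRotationDefectLiouville
import HarnessLib

/-!
# Crux `Target` (stmt-NavierStokesRegularity-1217), line `killing-twisted-bernoulli-solitons`:
  the rotation-defect stratum in Pineau–Vicol's weighted-`L²` language (tool for stub B5b)

Support file (theorems only, `--supports stmt-NavierStokesRegularity-1217`). Pineau–Vicol prove
the large-`|α|` half of their Theorem 1.4 (arXiv:2607.09619) by showing that a weighted `L²`
norm of the rotation defect `RU = JU − (Jy·∇)U` is `≪ 1/α` (Prop. 6.5: "it is important that we
obtain a weighted-`L²` bound on `RU` which is `≪ 1/α` as opposed to merely `≲ 1/α`", p. 5).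
The rotation-defect stratum (`rotationDefect_liouville`, previous file) makes the threshold a
definite constant: here it is restated, by Cauchy–Schwarz against the class bound
`∫ ‖U + ½y‖² e^{−|y|²/16} ≤ A(C₀)`, as

* `rotationDefect_liouville_sq` — for every `C₀ > 0` there is `δ₂ = δ₂(C₀) > 0` such that a
  Type-I rotated self-similar solution of Pineau–Vicol's class with
  `α² ∫ ‖RU‖² e^{−|y|²/16} dy ≤ δ₂` is trivial. Contrapositive: a non-trivial soliton in the window
  has `‖e^{−|y|²/32} RU‖_{L²} > √δ₂ / |α|` — exactly the "`≪ 1/α`" that is available for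
  `|α| ≫ 1` and unavailable at `α ≈ 1`.

## References

* B. Pineau, V. Vicol, arXiv:2607.09619 (2026): §1.2 p. 5, Prop. 6.5 (p. 19), (6.9). [PineauVicol2026]
-/

noncomputable section

namespace Summit.NavierStokesRegularity.NavierStokesRegularity.Theorems

open MeasureTheory Set Function Filter Topology InnerProductSpace Real Metric
open scoped RealInnerProductSpace Laplacian ContDiff BigOperators ENNReal NNReal
open Literature.Analysis.FluidPDE Literature.Analysis.FluidPDE.PineauVicol2026

/-- **Cauchy–Schwarz for two continuous, Gaussian-dominated nonnegative factors**:
`(∫ f g)² ≤ (∫ f²)(∫ g²)` when `f, g ≥ 0` are continuous with `f², g²` integrable. [folklore] -/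
theorem rotationDefect_integral_mul_sq_le {f g : EuclideanSpace ℝ (Fin 3) → ℝ}
    (hf : Continuous f) (hg : Continuous g) (hf0 : ∀ y, 0 ≤ f y) (hg0 : ∀ y, 0 ≤ g y)
    (hf2 : Integrable fun y => f y ^ 2) (hg2 : Integrable fun y => g y ^ 2) :
    (∫ y, f y * g y) ^ 2 ≤ (∫ y, f y ^ 2) * ∫ y, g y ^ 2 := by
  have hfm : MemLp f (ENNReal.ofReal 2) volume := by
    rw [show ENNReal.ofReal 2 = 2 by norm_num,
      memLp_two_iff_integrable_sq hf.aestronglyMeasurable]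
    exact hf2
  have hgm : MemLp g (ENNReal.ofReal 2) volume := by
    rw [show ENNReal.ofReal 2 = 2 by norm_num,
      memLp_two_iff_integrable_sq hg.aestronglyMeasurable]
    exact hg2
  have h := integral_mul_le_Lp_mul_Lq_of_nonneg Real.HolderConjugate.two_two
    (Eventually.of_forall hf0) (Eventually.of_forall hg0) hfm hgm
  have hA : 0 ≤ ∫ y, f y ^ 2 := integral_nonneg fun y => sq_nonneg _
  have hB : 0 ≤ ∫ y, g y ^ 2 := integral_nonneg fun y => sq_nonneg _
  have hI : 0 ≤ ∫ y, f y * g y := integral_nonneg fun y => mul_nonneg (hf0 y) (hg0 y)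
  have e1 : (∫ y, f y ^ (2 : ℝ)) = ∫ y, f y ^ 2 := by
    refine integral_congr_ae (Eventually.of_forall fun y => ?_); simp
  have e2 : (∫ y, g y ^ (2 : ℝ)) = ∫ y, g y ^ 2 := by
    refine integral_congr_ae (Eventually.of_forall fun y => ?_); simp
  have ha : (∫ y, f y ^ 2) ^ (1 / 2 : ℝ) = Real.sqrt (∫ y, f y ^ 2) := (Real.sqrt_eq_rpow _).symm
  have hb : (∫ y, g y ^ 2) ^ (1 / 2 : ℝ) = Real.sqrt (∫ y, g y ^ 2) := (Real.sqrt_eq_rpow _).symm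
  rw [e1, e2, ha, hb] at h
  calc (∫ y, f y * g y) ^ 2 ≤ (Real.sqrt (∫ y, f y ^ 2) * Real.sqrt (∫ y, g y ^ 2)) ^ 2 :=
        pow_le_pow_left₀ hI h 2
    _ = (∫ y, f y ^ 2) * ∫ y, g y ^ 2 := by rw [mul_pow, Real.sq_sqrt hA, Real.sq_sqrt hB]

/-- **The rotation-defect stratum in weighted `L²`.** For every `C₀ > 0` there is `δ₂ > 0`
(depending on `C₀` only) such that: a classical Navier–Stokes solution `(u, p)` on `[−1, 0)`
with the Type-I bound `‖u(t,x)‖ ≤ C₀/(‖x‖ + √−t)`, rotated self-similar with speed `α` and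
profile `U` (`u = pvAnsatz α U`), whose rotation defect satisfies
`α² ∫ ‖JU(y) − DU(y)(Jy)‖² e^{−|y|²/16} dy ≤ δ₂`, has `U = 0`. (Cauchy–Schwarz:
`|α| ∫ ‖U + ½y‖‖RU‖ e^{−|y|²/16} ≤ √(A(C₀)) · |α| ‖e^{−|y|²/32}RU‖_{L²}` with
`A(C₀) ≥ ∫ ‖U + ½y‖² e^{−|y|²/16}`, then `rotationDefect_liouville`.) In the window this is the
statement that Pineau–Vicol's large-`|α|` smallness `‖RU‖_{L²} ≪ 1/α` (Prop. 6.5) fails by a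
definite amount on any counterexample. [cite: PineauVicol2026, §1.2 (p. 5), Prop. 6.5 (p. 19)] -/
theorem rotationDefect_liouville_sq {C₀ : ℝ} (hC₀ : 0 < C₀) :
    ∃ δ₂ : ℝ, 0 < δ₂ ∧ ∀ (α : ℝ) (u : ℝ → EuclideanSpace ℝ (Fin 3) → EuclideanSpace ℝ (Fin 3))
      (p : ℝ → EuclideanSpace ℝ (Fin 3) → ℝ) (U : EuclideanSpace ℝ (Fin 3) → EuclideanSpace ℝ (Fin 3)),
      IsClassicalNSSolutionOn (Ico (-1) 0) 1 0 u p →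
      (∀ t ∈ Ico (-1 : ℝ) 0, ∀ x, ‖u t x‖ ≤ C₀ / (‖x‖ + Real.sqrt (-t))) →
      (∀ t ∈ Ico (-1 : ℝ) 0, ∀ x, u t x = pvAnsatz α (fun y _ => U y) t x) →
      α ^ 2 * (∫ y, ‖rotGen (U y) - fderiv ℝ U y (rotGen y)‖ ^ 2 * Real.exp (-‖y‖ ^ 2 / 16)) ≤ δ₂ →
      U = 0 := by
  obtain ⟨δ, hδ, hliou⟩ := rotationDefect_liouville hC₀
  obtain ⟨Kd, hKd0, hKd⟩ := rotationDefect_uniform_fderiv_bound C₀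
  -- the class bound `A` on `∫ ‖U + ½y‖² e^{−|y|²/16}`
  set GA : EuclideanSpace ℝ (Fin 3) → ℝ := fun y =>
    (C₀ + 1) ^ 2 * ((1 + ‖y‖) ^ 2 * Real.exp (-(1 / 16 : ℝ) * ‖y‖ ^ 2)) with hGA
  have hGAi : Integrable GA :=
    (integrable_one_add_norm_pow_mul_exp_neg_mul_sq (E := EuclideanSpace ℝ (Fin 3))
      (c := 1 / 16) (by norm_num) 2).const_mul _
  set A : ℝ := ∫ y, GA y with hA_def
  have hA0 : 0 ≤ A := integral_nonneg fun y => by simp only [hGA]; positivity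
  refine ⟨δ ^ 2 / (A + 1), by positivity, fun α u p U hsol hI hans hsmall => ?_⟩
  refine hliou α u p U hsol hI hans ?_
  -- the players
  have hUb' : ∀ y, ‖U y‖ ≤ C₀ / (‖y‖ + 1) := profile_bound_of_typeI hI hans
  have hUb : ∀ y, ‖U y‖ ≤ C₀ := fun y =>
    (hUb' y).trans (div_le_self hC₀.le (by linarith [norm_nonneg y]))
  have hDU : ∀ y, ‖fderiv ℝ U y‖ ≤ Kd := hKd α u p U hsol hI hans
  obtain ⟨P, hU, -, -, -⟩ := rss_profile_system α u p U hsol hans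
  have hUc : Continuous U := hU.continuous
  have hDUc : Continuous fun y => fderiv ℝ U y := hU.continuous_fderiv (by simp)
  have hJc : Continuous (rotGen : EuclideanSpace ℝ (Fin 3) → EuclideanSpace ℝ (Fin 3)) :=
    rotGenL.continuous.congr fun v => rfl
  have hexpc : Continuous fun y : EuclideanSpace ℝ (Fin 3) => Real.exp (-‖y‖ ^ 2 / 32) :=
    Real.continuous_exp.comp ((continuous_norm.pow 2).neg.div_const _)
  have hexp_sq : ∀ y : EuclideanSpace ℝ (Fin 3),
      Real.exp (-‖y‖ ^ 2 / 32) ^ 2 = Real.exp (-‖y‖ ^ 2 / 16) := fun y => by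
    rw [← Real.exp_nat_mul]; congr 1; ring
  -- `f = ‖U + ½y‖ e^{−|y|²/32}`, `g = ‖RU‖ e^{−|y|²/32}`
  set f : EuclideanSpace ℝ (Fin 3) → ℝ := fun y => ‖U y + (1 / 2 : ℝ) • y‖ * Real.exp (-‖y‖ ^ 2 / 32)
    with hf
  set g : EuclideanSpace ℝ (Fin 3) → ℝ := fun y =>
    ‖rotGen (U y) - fderiv ℝ U y (rotGen y)‖ * Real.exp (-‖y‖ ^ 2 / 32) with hg
  have hfc : Continuous f :=
    (continuous_norm.comp (hUc.add (continuous_id.const_smul (1 / 2 : ℝ)))).mul hexpc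
  have hgc : Continuous g :=
    (continuous_norm.comp ((hJc.comp hUc).sub (hDUc.clm_apply hJc))).mul hexpc
  have hf0 : ∀ y, 0 ≤ f y := fun y => mul_nonneg (norm_nonneg _) (Real.exp_pos _).le
  have hg0 : ∀ y, 0 ≤ g y := fun y => mul_nonneg (norm_nonneg _) (Real.exp_pos _).le
  have hfg : ∀ y, f y * g y = ‖U y + (1 / 2 : ℝ) • y‖ * ‖rotGen (U y) - fderiv ℝ U y (rotGen y)‖ *
      Real.exp (-‖y‖ ^ 2 / 16) := fun y => by
    simp only [hf, hg]; rw [← hexp_sq y]; ring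
  have hf2_eq : ∀ y, f y ^ 2 = ‖U y + (1 / 2 : ℝ) • y‖ ^ 2 * Real.exp (-‖y‖ ^ 2 / 16) := fun y => by
    simp only [hf]; rw [mul_pow, hexp_sq y]
  have hg2_eq : ∀ y, g y ^ 2 = ‖rotGen (U y) - fderiv ℝ U y (rotGen y)‖ ^ 2 *
      Real.exp (-‖y‖ ^ 2 / 16) := fun y => by
    simp only [hg]; rw [mul_pow, hexp_sq y]
  -- `f² ≤ GA`, hence integrable with `∫ f² ≤ A`
  have hf2_le : ∀ y, f y ^ 2 ≤ GA y := fun y => by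
    rw [hf2_eq y]
    have e : Real.exp (-‖y‖ ^ 2 / 16) = Real.exp (-(1 / 16 : ℝ) * ‖y‖ ^ 2) := by congr 1; ring
    rw [e]
    have h1 : ‖U y + (1 / 2 : ℝ) • y‖ ^ 2 ≤ ((C₀ + 1) * (1 + ‖y‖)) ^ 2 :=
      pow_le_pow_left₀ (norm_nonneg _) (rotationDefect_norm_drift_le hC₀.le hUb y) 2
    calc ‖U y + (1 / 2 : ℝ) • y‖ ^ 2 * Real.exp (-(1 / 16 : ℝ) * ‖y‖ ^ 2)
        ≤ ((C₀ + 1) * (1 + ‖y‖)) ^ 2 * Real.exp (-(1 / 16 : ℝ) * ‖y‖ ^ 2) :=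
          mul_le_mul_of_nonneg_right h1 (Real.exp_pos _).le
      _ = GA y := by simp only [hGA]; ring
  have hf2i : Integrable fun y => f y ^ 2 :=
    hGAi.mono' (hfc.pow 2).aestronglyMeasurable (Eventually.of_forall fun y => by
      rw [Real.norm_of_nonneg (sq_nonneg _)]; exact hf2_le y)
  have hf2A : ∫ y, f y ^ 2 ≤ A := integral_mono hf2i hGAi hf2_le
  -- `g²` integrable (bounded defect times Gaussian)
  have hg2i : Integrable fun y => g y ^ 2 := by
    have hgi : Integrable fun y : EuclideanSpace ℝ (Fin 3) => Real.exp (-(1 / 16 : ℝ) * ‖y‖ ^ 2) :=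
      integrable_exp_neg_mul_sq_norm' (E := EuclideanSpace ℝ (Fin 3)) (b := 1 / 16) (by norm_num)
    refine (((integrable_one_add_norm_pow_mul_exp_neg_mul_sq (E := EuclideanSpace ℝ (Fin 3))
      (c := 1 / 16) (by norm_num) 2).const_mul ((C₀ + Kd) ^ 2))).mono' (hgc.pow 2).aestronglyMeasurable
      (Eventually.of_forall fun y => ?_)
    rw [Real.norm_of_nonneg (sq_nonneg _), hg2_eq y]
    have e : Real.exp (-‖y‖ ^ 2 / 16) = Real.exp (-(1 / 16 : ℝ) * ‖y‖ ^ 2) := by congr 1; ring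
    rw [e]
    have h1 : ‖rotGen (U y) - fderiv ℝ U y (rotGen y)‖ ^ 2 ≤ ((C₀ + Kd) * (1 + ‖y‖)) ^ 2 :=
      pow_le_pow_left₀ (norm_nonneg _) (rotationDefect_norm_defect_le hC₀.le hUb hDU y) 2
    calc ‖rotGen (U y) - fderiv ℝ U y (rotGen y)‖ ^ 2 * Real.exp (-(1 / 16 : ℝ) * ‖y‖ ^ 2)
        ≤ ((C₀ + Kd) * (1 + ‖y‖)) ^ 2 * Real.exp (-(1 / 16 : ℝ) * ‖y‖ ^ 2) :=
          mul_le_mul_of_nonneg_right h1 (Real.exp_pos _).le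
      _ = (C₀ + Kd) ^ 2 * ((1 + ‖y‖) ^ 2 * Real.exp (-(1 / 16 : ℝ) * ‖y‖ ^ 2)) := by ring
  -- Cauchy–Schwarz
  have hCS := rotationDefect_integral_mul_sq_le hfc hgc hf0 hg0 hf2i hg2i
  have hFeq : (∫ y, ‖U y + (1 / 2 : ℝ) • y‖ * ‖rotGen (U y) - fderiv ℝ U y (rotGen y)‖ *
      Real.exp (-‖y‖ ^ 2 / 16)) = ∫ y, f y * g y :=
    integral_congr_ae (Eventually.of_forall fun y => (hfg y).symm)
  have hBeq : (∫ y, ‖rotGen (U y) - fderiv ℝ U y (rotGen y)‖ ^ 2 * Real.exp (-‖y‖ ^ 2 / 16)) =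
      ∫ y, g y ^ 2 := integral_congr_ae (Eventually.of_forall fun y => (hg2_eq y).symm)
  rw [hFeq]
  rw [hBeq] at hsmall
  set I : ℝ := ∫ y, f y * g y with hI_def
  set B : ℝ := ∫ y, g y ^ 2 with hB_def
  have hI0 : 0 ≤ I := integral_nonneg fun y => mul_nonneg (hf0 y) (hg0 y)
  have hB0 : 0 ≤ B := integral_nonneg fun y => sq_nonneg _
  -- `(|α| I)² ≤ α² A B ≤ A δ²/(A+1) ≤ δ²`
  have h1 : (|α| * I) ^ 2 ≤ A * (α ^ 2 * B) := by
    calc (|α| * I) ^ 2 = α ^ 2 * I ^ 2 := by rw [mul_pow, sq_abs]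
      _ ≤ α ^ 2 * ((∫ y, f y ^ 2) * B) := mul_le_mul_of_nonneg_left hCS (sq_nonneg _)
      _ ≤ α ^ 2 * (A * B) := mul_le_mul_of_nonneg_left
          (mul_le_mul_of_nonneg_right hf2A hB0) (sq_nonneg _)
      _ = A * (α ^ 2 * B) := by ring
  have h2 : (|α| * I) ^ 2 ≤ δ ^ 2 := by
    calc (|α| * I) ^ 2 ≤ A * (α ^ 2 * B) := h1
      _ ≤ A * (δ ^ 2 / (A + 1)) := mul_le_mul_of_nonneg_left hsmall hA0
      _ ≤ δ ^ 2 := by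
          rw [mul_div_assoc']
          rw [div_le_iff₀ (by positivity)]
          nlinarith [sq_nonneg δ]
  have hx0 : 0 ≤ |α| * I := mul_nonneg (abs_nonneg α) hI0
  exact (pow_le_pow_iff_left₀ hx0 hδ.le (by norm_num : (2 : ℕ) ≠ 0)).1 h2


/-! ### Registered form -/

/-- **Registered helper stub `rotationDefect_liouvilleSq`** (explicit-binder form of
`rotationDefect_liouville_sq`): the rotation-defect stratum in weighted `L²`,
`α² ∫ ‖RU‖² e^{−|y|²/16} ≤ δ₂(C₀) ⇒ U = 0` for Type-I RSS solutions.
[cite: PineauVicol2026, §1.2 (p. 5), Prop. 6.5 (p. 19)] -/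
theorem rotationDefect_liouvilleSq :
    ∀ (C₀ : ℝ), 0 < C₀ → ∃ δ₂ : ℝ, 0 < δ₂ ∧ ∀ (α : ℝ) (u : ℝ → EuclideanSpace ℝ (Fin 3) → EuclideanSpace ℝ (Fin 3)) (p : ℝ → EuclideanSpace ℝ (Fin 3) → ℝ) (U : EuclideanSpace ℝ (Fin 3) → EuclideanSpace ℝ (Fin 3)), Literature.Analysis.FluidPDE.IsClassicalNSSolutionOn (Set.Ico (-1) 0) 1 0 u p → (∀ t ∈ Set.Ico (-1 : ℝ) 0, ∀ x : EuclideanSpace ℝ (Fin 3), ‖u t x‖ ≤ C₀ / (‖x‖ + Real.sqrt (-t))) → (∀ t ∈ Set.Ico (-1 : ℝ) 0, ∀ x : EuclideanSpace ℝ (Fin 3), u t x = Literature.Analysis.FluidPDE.pvAnsatz α (fun y _ => U y) t x) → α ^ 2 * (∫ y : EuclideanSpace ℝ (Fin 3), ‖Literature.Analysis.FluidPDE.rotGen (U y) - fderiv ℝ U y (Literature.Analysis.FluidPDE.rotGen y)‖ ^ 2 * Real.exp (-‖y‖ ^ 2 / 16)) ≤ δ₂ → U = 0 :=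
  fun _ hC₀ => rotationDefect_liouville_sq hC₀

end Summit.NavierStokesRegularity.NavierStokesRegularity.Theorems

end
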